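import Literature.NumberTheory.EllipticCurves.CanonicalPAdicHeightIntegralityAnomalousProofs
import HarnessLib

/-!
# Height integrality by isogeny descent (memo H-int): THE canonical cyclotomic `p`-adic height of
# the member whose `p`-isogeny kills the `p`-part of reduction is `p`-INTEGRAL

Support file (prover seat `bsd-schneider-i1-c2`, gen 6, cell `bsd-schneider-ideate`; `--supports
stmt-BirchSwinnertonDyer-19086`), fourth of the regulator-floor series (`…RegulatorFloor` p448248,
`…RegulatorFloorPub` p448618, `…RegulatorFloorSharp` p449700), which reduced memo ROUTE-P3-v8's T-λ3
(«`λ_an ≥ 3` on corner A2») to the floor AT THE PAIR `Reg_p ≠ 0 → 0 ≤ ord_p Reg_p + ord_p ∏c_ℓ` and proved only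
the crude floor `ord_p Reg_p ≥ −1`. The missing unit is the memo's Lemma H-int (§1.3): push the point through the
degree-`p` isogeny `φ : E → E' = E/Φ` — proved here for an ABSTRACT additive map `f : E(ℚ) → E'(ℚ)` (§1–§2, no
named fact); the isogeny form (modulo Mazur–Tate's adjunction MT83 (3.4.3), stated there as a cite-tagged named
fact) and the corner-A2 consequences (floor, T-λ3) are in the companion `…HeightIntegralityIsogeny.lean`.

MECHANISM (kernel-checked, §2). Let `f = φ(ℚ) : E(ℚ) → E'(ℚ)` be additive and suppose
 (red)  `p • R ∈ E₁(ℚ_p) ⇒ f R ∈ E'₁(ℚ_p)` for `R ∈ E(ℚ)` — what «`ker φ = Φ` with `Φ(ℚ̄_p) ⊂ E(ℚ_p)` reducing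
        onto `Ẽ(𝔽_p)[p]`» gives on the member `E₁` of an A2 class (`R ≡ T mod E₁(ℚ_p)`, `T ∈ Φ`,
        `φ R = φ(R − T) ∈ φ(E₁(ℚ_p)) ⊆ E'₁(ℚ_p)`; memo v8 §1.3 (b), kit j253553: 560/560 A2 pairs);
 (comp) `f` maps `E(ℚ) ∩ E⁰(ℚ_ℓ)` into `E'(ℚ) ∩ E'⁰(ℚ_ℓ)` for every prime `ℓ` (Néron mapping property: `φ`
        extends to the Néron models and respects identity components);
 (adj)  `⟨f P, f Q⟩' = p·⟨P, Q⟩` for THE canonical data (Mazur–Tate 1983 (3.4.3) + `φ̂ ∘ φ = [p]`, companion);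
 and `ord_p #Ẽ(𝔽_p) ≤ 1` (Hasse; `= 1` on A2), `p ∤ [E(ℚ) : E(ℚ) ∩ E⁰(ℚ_ℓ)]` for all `ℓ` (e.g. `p ∤ ∏c_ℓ(E)`:
 1 765 of the 2 797 A2 class-pairs, P3 census j252884; NOT `p ∤ ∏c_ℓ(E')`, which fails generically — the quotient
 by the unramified line acquires `p ∣ c_ℓ(E')` at the multiplicative primes, kit j257192: 14/15).
Then for `Q ∈ E(ℚ)`: `N_p = p^v m`, `p ∤ m`, `p • (m • Q) ∈ E₁(ℚ_p)` (AEC VII.2.1), so `m • fQ ∈ E'₁(ℚ_p)` by (red);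
`m₀ • Q ∈ E⁰(ℚ_ℓ)` at the finitely many primes where `fQ` may reduce singularly, `p ∤ m₀`, so `m₀ • fQ ∈ E'⁰(ℚ_ℓ)`
there by (comp) and trivially elsewhere; `(m m₀) • fQ` is ADMISSIBLE on `E'` (§1) and the landed sigma-formula bound
gives `‖ĥ'((m m₀) • fQ)‖ ≤ p⁻¹` (`norm_pairing_self_le_of_isAdmissible`, MST 2006 (1.1)); as `p ∤ m m₀`,
`‖⟨fQ, fQ⟩'‖ ≤ p⁻¹`, and by (adj) `‖⟨Q, Q⟩‖ ≤ 1`: **THE canonical height of `E` is `p`-integral**, hence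
`‖Reg_p‖ ≤ 1` and `0 ≤ ord_p Reg_p` (§2).

* §1 good position: `isAdmissible_mul_nsmul` (a multiple in `E₁(ℚ_p)` and a multiple in `E⁰(ℚ_ℓ) ∀ℓ` give an
  admissible multiple); `exists_coprime_nsmul_mem_nonsingularReductionSubgroupAt_map` ((comp) transports good
  position away from `p`, multiplier prime to `p` taken from the indices of `E`).
* §2 H-int for an ABSTRACT `f` with (red), (comp), (adj) as hypotheses — no named fact:
  `norm_pairing_self_le_one_of_isogenyDescent`, `norm_pairing_le_one_of_isogenyDescent` (polarisation, `p` odd),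
  `norm_padicRegulator_le_one_of_isogenyDescent` (ultrametric Hadamard), `valuation_padicRegulator_nonneg_…`.

HONEST NOTE. (red) and (comp) are per-isogeny STRUCTURAL hypotheses, not published facts taken on faith: both are
instances of the Néron mapping property for `φ` (AEC VII.2, IV.6), which the tree cannot state yet (its `Isogeny`
is a homomorphism of `ℚ̄`-points; no map on `ℚ_p`-points compatible with reduction — cf. the named fact
`WeierstrassCurve.Isogeny.hasLocalPointsMaps`); (adj) is discharged from MT83 (3.4.3) in the companion file.
Item 19086 is untouched (DECIDED-REDUCED, gens 0–5): this constrains the complement `{λ_an = 1}` of its locus.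

References: Mazur–Tate, *Canonical height pairings via biextensions*, Progr. Math. 35 (1983), §3.4 (3.4.3)
[MazurTate1983Biext]; Mazur–Stein–Tate, Doc. Math. Extra Vol. (2006), §1 (1.1), §2.6–2.8 [MazurSteinTate2006];
Silverman, AEC (2009) III.6.1–6.2, VII.2.1 [SilvermanAEC2009]; memo ROUTE-P3-v8-lambda-g10 §1.3; FINDING-i1-c2-g5 §3.
-/

set_option autoImplicit false

noncomputable section

open scoped Classical

open WeierstrassCurve Literature.NumberTheory.EllipticCurves

set_option linter.dupNamespace false -- summit = sub-problem name (D-0017 layout)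

namespace Summit.BirchSwinnertonDyer.BirchSwinnertonDyer.Theorems.DegenerateLocusA2HeightIntegrality

variable {W W' : WeierstrassCurve ℚ} [W.IsGloballyMinimal] [W'.IsGloballyMinimal] {p : ℕ} [Fact p.Prime]

/-! ## §1. Kernel of reduction and good position on rational points -/

/-- `R ∈ E₁(ℚ_p) ∩ E(ℚ)` (the tree's `kernelOfReductionAt`) iff the `ℚ_p`-point of `R` lies in the kernel of
reduction (`IsInReductionKernel`, `‖x‖_p > 1`). [folklore] -/
theorem mem_kernelOfReductionAt_iff_isInReductionKernel (R : W.toAffine.Point) :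
    R ∈ W.kernelOfReductionAt p ↔ (W.baseChange ℚ_[p]).IsInReductionKernel (W.toPadicPoint p R) := by
  rcases R with _ | ⟨x, y, h⟩
  · refine ⟨fun _ => ?_, fun _ => ?_⟩
    · rw [show (Affine.Point.zero : W.toAffine.Point) = 0 from rfl, map_zero]
      exact (W.baseChange ℚ_[p]).isInReductionKernel_zero
    · exact (W.kernelOfReductionAt p).zero_mem
  · rw [some_mem_kernelOfReductionAt_iff, toPadicPoint_some, isInReductionKernel_some]

/-- **`N_p · E(ℚ) ⊆ E₁(ℚ_p)`** at a good prime, `N_p = #Ẽ(𝔽_p)` (AEC VII.2.1; the tree's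
`isInReductionKernel_reductionPointCount_nsmul` read on rational points). [cite: SilvermanAEC2009, VII.2.1] -/
theorem reductionPointCount_nsmul_mem_kernelOfReductionAt (hgood : W.HasGoodReductionAtPrime p)
    (R : W.toAffine.Point) : W.reductionPointCount p • R ∈ W.kernelOfReductionAt p := by
  rw [mem_kernelOfReductionAt_iff_isInReductionKernel, map_nsmul]
  exact W.isInReductionKernel_reductionPointCount_nsmul p
    (not_dvd_minimalDiscriminantInt_of_hasGoodReductionAtPrime' W p hgood) _

/-- **An admissible multiple from a multiple in `E₁(ℚ_p)` and a multiple in good position.** For `W/ℚ` globally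
minimal, `p` odd, `R ∈ E(ℚ)` non-torsion with `m₁ • R ∈ E₁(ℚ_p)` and `m₀ • R ∈ E⁰(ℚ_ℓ)` for every prime `ℓ`
(`m₁, m₀ ≠ 0`), the point `(m₁ m₀) • R` is admissible (in `E₁(ℚ_p)`, in the sigma disc since `p` is odd,
non-singular reduction everywhere, non-torsion). [cite: MazurSteinTate2006, §1 and Alg. 3.4 step 1]
[cite: SilvermanAEC2009, VII.2.1 and VII.6.1] -/
theorem isAdmissible_mul_nsmul (hp2 : p ≠ 2) {R : W.toAffine.Point} (hR : ¬ IsOfFinAddOrder R) {m₁ m₀ : ℕ}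
    (hm₁ : m₁ ≠ 0) (hm₀ : m₀ ≠ 0) (hker : m₁ • R ∈ W.kernelOfReductionAt p)
    (hnsr : ∀ (ℓ : ℕ) [Fact ℓ.Prime], m₀ • R ∈ W.nonsingularReductionSubgroupAt ℓ) :
    W.IsAdmissible p ((m₁ * m₀) • R) := by
  have hQfin : ¬ IsOfFinAddOrder ((m₁ * m₀) • R) := fun hf => hR (hf.of_nsmul (Nat.mul_ne_zero hm₁ hm₀))
  have hQ₀ : ∀ (ℓ : ℕ) [Fact ℓ.Prime], (m₁ * m₀) • R ∈ W.nonsingularReductionSubgroupAt ℓ := by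
    intro ℓ _
    rw [mul_comm, mul_nsmul R]
    exact AddSubgroup.nsmul_mem _ (hnsr ℓ) _
  have hQker : (m₁ * m₀) • R ∈ W.kernelOfReductionAt p := by
    rw [mul_nsmul R]
    exact AddSubgroup.nsmul_mem _ hker _
  obtain ⟨xq, yq, hq, hQeq⟩ := exists_eq_some_of_not_isOfFinAddOrder hQfin
  rw [hQeq] at hQ₀ hQfin hQker ⊢
  rw [some_mem_kernelOfReductionAt_iff] at hQker
  refine ⟨hQfin, hQker, (W.inSigmaDisc_of_one_lt_norm hp2 hq hQker).2, fun ℓ hℓ => ?_⟩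
  haveI := Fact.mk hℓ
  exact (W.reducesNonsingularlyAt_some ℓ _).mp ((mem_nonsingularReductionSubgroupAt_iff _).mp (hQ₀ ℓ))

/-- **(comp) transports good position away from `p`, with a prime-to-`p` multiplier.** If `f : E(ℚ) → E'(ℚ)` is
additive and maps `E(ℚ) ∩ E⁰(ℚ_ℓ)` into `E'(ℚ) ∩ E'⁰(ℚ_ℓ)` for every prime `ℓ`, and `p ∤ [E(ℚ) : E(ℚ) ∩ E⁰(ℚ_ℓ)]`
for every `ℓ`, then every `f Q` of infinite order has a multiple `m₀ • f Q`, `p ∤ m₀`, in `E'⁰(ℚ_ℓ)` for ALL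
primes `ℓ`: take `m₀ = ∏_{ℓ ∈ S} [E(ℚ) : E(ℚ) ∩ E⁰(ℚ_ℓ)]` over the finitely many primes `S` at which `f Q` may
reduce singularly (`exists_finset_forall_hasNonsingularReductionAt`); at `ℓ ∈ S`, `m₀ • Q ∈ E⁰` and (comp); at
`ℓ ∉ S`, `f Q ∈ E'⁰` already. [cite: SilvermanAEC2009, VII.6.1] -/
theorem exists_coprime_nsmul_mem_nonsingularReductionSubgroupAt_map
    (hidx : ∀ (ℓ : ℕ) [Fact ℓ.Prime], ¬ p ∣ (W.nonsingularReductionSubgroupAt ℓ).index)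
    (f : W.toAffine.Point →+ W'.toAffine.Point)
    (hcomp : ∀ (ℓ : ℕ) [Fact ℓ.Prime], ∀ R ∈ W.nonsingularReductionSubgroupAt ℓ,
      f R ∈ W'.nonsingularReductionSubgroupAt ℓ)
    {Q : W.toAffine.Point} (hfQ : ¬ IsOfFinAddOrder (f Q)) :
    ∃ m₀ : ℕ, ¬ p ∣ m₀ ∧ ∀ (ℓ : ℕ) [Fact ℓ.Prime], m₀ • f Q ∈ W'.nonsingularReductionSubgroupAt ℓ := by
  have hpp : p.Prime := Fact.out
  obtain ⟨x, y, h, hfQeq⟩ := exists_eq_some_of_not_isOfFinAddOrder hfQ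
  -- the finitely many primes at which `f Q` may have singular reduction
  obtain ⟨S, hS⟩ := exists_finset_forall_hasNonsingularReductionAt h
  set e0 : ℕ → ℕ := fun ℓ =>
    if hℓ : ℓ.Prime then (haveI := Fact.mk hℓ; (W.nonsingularReductionSubgroupAt ℓ).index) else 1
    with he0def
  have he0 : ∀ ℓ, ¬ p ∣ e0 ℓ := fun ℓ => by
    simp only [he0def]
    split_ifs with hℓ
    · haveI := Fact.mk hℓ; exact hidx ℓ
    · exact hpp.not_dvd_one
  refine ⟨∏ ℓ ∈ S, e0 ℓ, fun hdvd => ?_, fun ℓ _ => ?_⟩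
  · obtain ⟨ℓ, -, hℓ⟩ := (Prime.dvd_finsetProd_iff hpp.prime _).mp hdvd
    exact he0 ℓ hℓ
  · by_cases hℓS : ℓ ∈ S
    · obtain ⟨k, hk⟩ : e0 ℓ ∣ ∏ ℓ ∈ S, e0 ℓ := Finset.dvd_prod_of_mem e0 hℓS
      rw [hk, ← map_nsmul, mul_nsmul Q]
      refine hcomp ℓ _ (AddSubgroup.nsmul_mem _ ?_ k)
      have : e0 ℓ = (W.nonsingularReductionSubgroupAt ℓ).index := by
        simp only [he0def, dif_pos (Fact.out : ℓ.Prime)]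
      rw [this]
      exact AddSubgroup.nsmul_index_mem _ _
    · rw [hfQeq]
      exact AddSubgroup.nsmul_mem _ ((mem_nonsingularReductionSubgroupAt_iff _).mpr
        ((W'.reducesNonsingularlyAt_some ℓ h).mpr (hS ℓ Fact.out hℓS))) _

/-! ## §2. H-int for an abstract homomorphism: (red) + (comp) + (adj) ⇒ THE canonical height is `p`-integral -/

/-- **Lemma H-int (memo ROUTE-P3-v8 §1.3), abstract form: `‖⟨Q, Q⟩‖ ≤ 1` for every `Q ∈ E(ℚ)`.** Hypotheses:
`p ≥ 3` good for `E` with `ord_p #Ẽ(𝔽_p) ≤ 1`; `p ∤ [E(ℚ) : E(ℚ) ∩ E⁰(ℚ_ℓ)]` for all `ℓ`; an additive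
`f : E(ℚ) → E'(ℚ)` to a globally minimal `E'` with (red), (comp), and (adj) for THE canonical height datum `D'` of
`E'` (`D'.pairing (f P) (f Q) = p · D.pairing P Q`). Proof in the module docstring.
[cite: MazurSteinTate2006, §1 eq. (1.1) and Alg. 3.4] [cite: SilvermanAEC2009, VII.2.1] -/
theorem norm_pairing_self_le_one_of_isogenyDescent (hp : 3 ≤ p) (hgood : W.HasGoodReductionAtPrime p)
    (hN : padicValNat p (W.reductionPointCount p) ≤ 1)
    (hidx : ∀ (ℓ : ℕ) [Fact ℓ.Prime], ¬ p ∣ (W.nonsingularReductionSubgroupAt ℓ).index)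
    (f : W.toAffine.Point →+ W'.toAffine.Point)
    (hred : ∀ R : W.toAffine.Point, p • R ∈ W.kernelOfReductionAt p → f R ∈ W'.kernelOfReductionAt p)
    (hcomp : ∀ (ℓ : ℕ) [Fact ℓ.Prime], ∀ R ∈ W.nonsingularReductionSubgroupAt ℓ,
      f R ∈ W'.nonsingularReductionSubgroupAt ℓ)
    {D : PAdicHeightData W p} {D' : PAdicHeightData W' p} (hD' : D'.IsCanonical)
    (hadj : ∀ P Q : W.toAffine.Point, D'.pairing (f P) (f Q) = (p : ℚ_[p]) * D.pairing P Q)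
    (Q : W.toAffine.Point) : ‖D.pairing Q Q‖ ≤ 1 := by
  have hpp : p.Prime := Fact.out
  have hp2 : p ≠ 2 := by omega
  have hp0 : (0 : ℝ) < (p : ℝ)⁻¹ := by
    have : (0 : ℝ) < p := by exact_mod_cast hpp.pos
    positivity
  -- the image point pairs into `p ℤ_p`
  have hkey : ‖D'.pairing (f Q) (f Q)‖ ≤ (p : ℝ)⁻¹ := by
    by_cases hfQ : IsOfFinAddOrder (f Q)
    · rw [D'.map_torsion _ _ hfQ, norm_zero]; exact hp0.le
    -- a prime-to-`p` multiple of `f Q` in `E'₁(ℚ_p)`, by (red)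
    obtain ⟨m, hpm, hmker⟩ : ∃ m : ℕ, ¬ p ∣ m ∧ m • f Q ∈ W'.kernelOfReductionAt p := by
      set N := W.reductionPointCount p with hNdef
      have hN0 : N ≠ 0 := (W.reductionPointCount_pos p).ne'
      refine ⟨N / p ^ N.factorization p, Nat.not_dvd_ordCompl hpp hN0, ?_⟩
      have hsplit : p ^ N.factorization p * (N / p ^ N.factorization p) = N :=
        Nat.ordProj_mul_ordCompl_eq_self N p
      have hv : N.factorization p ≤ 1 := by rw [Nat.factorization_def N hpp]; exact hN
      -- `N ∣ p · m`
      have hdvd : N ∣ p * (N / p ^ N.factorization p) := by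
        rcases Nat.le_one_iff_eq_zero_or_eq_one.mp hv with h0 | h1
        · rw [h0, pow_zero, Nat.div_one]
          exact dvd_mul_left N p
        · rw [h1, pow_one] at hsplit ⊢
          exact dvd_of_eq hsplit.symm
      obtain ⟨c, hc⟩ := hdvd
      have hpm : p • ((N / p ^ N.factorization p) • Q) ∈ W.kernelOfReductionAt p := by
        rw [← mul_nsmul Q, mul_comm, hc, mul_nsmul Q]
        exact AddSubgroup.nsmul_mem _ (reductionPointCount_nsmul_mem_kernelOfReductionAt hgood Q) c
      have := hred _ hpm
      rwa [map_nsmul] at this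
    -- a prime-to-`p` multiple of `f Q` in good position away from `p`, by (comp)
    obtain ⟨m₀, hpm₀, hm₀⟩ :=
      exists_coprime_nsmul_mem_nonsingularReductionSubgroupAt_map hidx f hcomp hfQ
    have hm0 : m ≠ 0 := fun h0 ↦ hpm (h0 ▸ dvd_zero p)
    have hm₀0 : m₀ ≠ 0 := fun h0 ↦ hpm₀ (h0 ▸ dvd_zero p)
    have hadm := isAdmissible_mul_nsmul hp2 hfQ hm0 hm₀0 hmker hm₀
    set m' := m * m₀ with hm'
    have hpm' : ¬ p ∣ m' := fun hdvd ↦ ((Nat.Prime.dvd_mul hpp).mp hdvd).elim hpm hpm₀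
    have hmm : D'.pairing (m' • f Q) (m' • f Q) = ((m' : ℚ_[p]) * m') * D'.pairing (f Q) (f Q) := by
      rw [map_nsmul (D'.pairing (m' • f Q)) m' (f Q), D'.symm (m' • f Q) (f Q),
        map_nsmul (D'.pairing (f Q)) m' (f Q), smul_smul, nsmul_eq_mul, Nat.cast_mul]
    have hm1 : ‖(m' : ℚ_[p])‖ = 1 :=
      Padic.norm_natCast_eq_one_iff.mpr ((Nat.Prime.coprime_iff_not_dvd hpp).mpr hpm')
    have key := norm_pairing_self_le_of_isAdmissible W' p hp2 hD' hadm
    rwa [hmm, norm_mul, norm_mul, hm1, one_mul, one_mul] at key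
  -- transport by (adj): `‖p‖ · ‖⟨Q,Q⟩‖ ≤ p⁻¹`
  rw [hadj Q Q, norm_mul, Padic.norm_p] at hkey
  have h1 : (p : ℝ)⁻¹ * ‖D.pairing Q Q‖ ≤ (p : ℝ)⁻¹ * 1 := by rw [mul_one]; exact hkey
  exact le_of_mul_le_mul_left h1 hp0

/-- **H-int for all pairs: `‖⟨P, Q⟩‖ ≤ 1`** (polarisation of `norm_pairing_self_le_one_of_isogenyDescent`,
`‖2‖_p = 1` for odd `p`). [cite: MazurSteinTate2006, §1 and Alg. 3.4 step 4] -/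
theorem norm_pairing_le_one_of_isogenyDescent (hp : 3 ≤ p) (hgood : W.HasGoodReductionAtPrime p)
    (hN : padicValNat p (W.reductionPointCount p) ≤ 1)
    (hidx : ∀ (ℓ : ℕ) [Fact ℓ.Prime], ¬ p ∣ (W.nonsingularReductionSubgroupAt ℓ).index)
    (f : W.toAffine.Point →+ W'.toAffine.Point)
    (hred : ∀ R : W.toAffine.Point, p • R ∈ W.kernelOfReductionAt p → f R ∈ W'.kernelOfReductionAt p)
    (hcomp : ∀ (ℓ : ℕ) [Fact ℓ.Prime], ∀ R ∈ W.nonsingularReductionSubgroupAt ℓ,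
      f R ∈ W'.nonsingularReductionSubgroupAt ℓ)
    {D : PAdicHeightData W p} {D' : PAdicHeightData W' p} (hD' : D'.IsCanonical)
    (hadj : ∀ P Q : W.toAffine.Point, D'.pairing (f P) (f Q) = (p : ℚ_[p]) * D.pairing P Q)
    (P Q : W.toAffine.Point) : ‖D.pairing P Q‖ ≤ 1 := by
  have hpp : p.Prime := Fact.out
  have hp2 : p ≠ 2 := by omega
  have hdiag : ∀ R : W.toAffine.Point, ‖D.pairing R R‖ ≤ 1 := fun R ↦
    norm_pairing_self_le_one_of_isogenyDescent hp hgood hN hidx f hred hcomp hD' hadj R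
  have hpol : (2 : ℚ_[p]) * D.pairing P Q =
      D.pairing (P + Q) (P + Q) - D.pairing P P - D.pairing Q Q := by
    simp only [map_add, AddMonoidHom.add_apply, D.symm Q P]; ring
  have hsub : ∀ a b : ℚ_[p], ‖a - b‖ ≤ max ‖a‖ ‖b‖ := fun a b ↦ by
    rw [sub_eq_add_neg, ← norm_neg b]; exact IsUltrametricDist.norm_add_le_max a (-b)
  have h2 : ‖(2 : ℚ_[p])‖ = 1 := by
    have : ((2 : ℕ) : ℚ_[p]) = 2 := by norm_num
    rw [← this, Padic.norm_natCast_eq_one_iff]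
    exact (Nat.coprime_primes hpp Nat.prime_two).mpr hp2
  have key : ‖(2 : ℚ_[p]) * D.pairing P Q‖ ≤ 1 := by
    rw [hpol]
    refine (hsub _ _).trans (max_le ?_ (hdiag Q))
    exact (hsub _ _).trans (max_le (hdiag _) (hdiag P))
  rwa [norm_mul, h2, one_mul] at key

/-- **`‖Reg_p(D)‖ ≤ 1`** under H-int (ultrametric Hadamard on a Mordell–Weil basis, the tree's
`norm_padicRegulator_le_pow_of_forall_norm_pairing_le`). [cite: MazurTate1983Biext, (4.1.1)] -/
theorem norm_padicRegulator_le_one_of_isogenyDescent [W.IsElliptic] (hp : 3 ≤ p) (hgood : W.HasGoodReductionAtPrime p)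
    (hN : padicValNat p (W.reductionPointCount p) ≤ 1)
    (hidx : ∀ (ℓ : ℕ) [Fact ℓ.Prime], ¬ p ∣ (W.nonsingularReductionSubgroupAt ℓ).index)
    (f : W.toAffine.Point →+ W'.toAffine.Point)
    (hred : ∀ R : W.toAffine.Point, p • R ∈ W.kernelOfReductionAt p → f R ∈ W'.kernelOfReductionAt p)
    (hcomp : ∀ (ℓ : ℕ) [Fact ℓ.Prime], ∀ R ∈ W.nonsingularReductionSubgroupAt ℓ,
      f R ∈ W'.nonsingularReductionSubgroupAt ℓ)
    {D : PAdicHeightData W p} {D' : PAdicHeightData W' p} (hD' : D'.IsCanonical)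
    (hadj : ∀ P Q : W.toAffine.Point, D'.pairing (f P) (f Q) = (p : ℚ_[p]) * D.pairing P Q) :
    ‖padicRegulator D‖ ≤ 1 := by
  have h := norm_padicRegulator_le_pow_of_forall_norm_pairing_le W p zero_le_one
    (norm_pairing_le_one_of_isogenyDescent hp hgood hN hidx f hred hcomp hD' hadj)
  rwa [one_pow] at h

/-- **The regulator floor `0 ≤ ord_p Reg_p(D)`** (for `Reg_p ≠ 0`) under H-int — the valued half `v = 0`
of x1b's certificate `hReg` and the memo's (T3)-at-the-pair input, with NO height value inspected.
[cite: MazurTate1983Biext, §3.4 (3.4.3) and (4.1.1)] [cite: MazurSteinTate2006, §1 eq. (1.1)] -/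
theorem valuation_padicRegulator_nonneg_of_isogenyDescent [W.IsElliptic] (hp : 3 ≤ p)
    (hgood : W.HasGoodReductionAtPrime p) (hN : padicValNat p (W.reductionPointCount p) ≤ 1)
    (hidx : ∀ (ℓ : ℕ) [Fact ℓ.Prime], ¬ p ∣ (W.nonsingularReductionSubgroupAt ℓ).index)
    (f : W.toAffine.Point →+ W'.toAffine.Point)
    (hred : ∀ R : W.toAffine.Point, p • R ∈ W.kernelOfReductionAt p → f R ∈ W'.kernelOfReductionAt p)
    (hcomp : ∀ (ℓ : ℕ) [Fact ℓ.Prime], ∀ R ∈ W.nonsingularReductionSubgroupAt ℓ,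
      f R ∈ W'.nonsingularReductionSubgroupAt ℓ)
    {D : PAdicHeightData W p} {D' : PAdicHeightData W' p} (hD' : D'.IsCanonical)
    (hadj : ∀ P Q : W.toAffine.Point, D'.pairing (f P) (f Q) = (p : ℚ_[p]) * D.pairing P Q)
    (hR : padicRegulator D ≠ 0) : 0 ≤ (padicRegulator D).valuation := by
  have hpp : p.Prime := Fact.out
  have hp1 : (1 : ℝ) < p := by exact_mod_cast hpp.one_lt
  have h := norm_padicRegulator_le_one_of_isogenyDescent hp hgood hN hidx f hred hcomp hD' hadj
  rw [Padic.norm_eq_zpow_neg_valuation hR, ← zpow_zero (p : ℝ)] at h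
  have h' := (zpow_le_zpow_iff_right₀ hp1).mp h
  linarith

end Summit.BirchSwinnertonDyer.BirchSwinnertonDyer.Theorems.DegenerateLocusA2HeightIntegrality

end
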